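import Mathlib
import HarnessLib
import Literature.Geometry.Lorentzian.KerrSchildCoord

/-!
# Route ZeroEnergyKerrOrBomb · item `KerrModeStability` — the pointwise Lagrangian inequality

Helper file for item stmt-FinalStateConjecture-10024 (`KerrModeStability`). This is the algebraic
heart of the growth bound for the slice energy of a bounded Killing-mode pair (the "Lagrangian" or
Caccioppoli estimate): at a point where the inverse metric `g^{μν}` is `h`-close to the Minkowski
components `η^{μν}` (`h ≤ 1/72`, the far region of the Kerr–Schild chart), for two covectors
`a = dψ̃`, `b = dχ̃` whose time components are tied to the values by the eigen-relations
`a₀ = νΦ₀ − ωX₀`, `b₀ = ωΦ₀ + νX₀` with `|Φ₀|, |X₀| ≤ C_b`, a cut-off value `|z| ≤ 1` and a cut-off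
slope `|dᵢ| ≤ K_d`, the sum of the two integrands
`F_a = −(ν J⁰[a] − ω J⁰[b]) z² Φ₀ + ∑ᵢ J^{i+1}[a] (2 z dᵢ Φ₀ + z² a_{i+1})` (and `F_b`) obtained by
integrating `∂ᵢ(ζ² Φ̃ J^{i+1})` by parts dominates `(4/9) z² (|∇a|² + |∇b|²)` up to an explicit
zeroth-order constant (`kerr_lagrangian_pointwise`): `Q[a] = ∑ g^{μν} a_μ a_ν ≥ −a₀² + |∇a|² − h
(∑|a_μ|)²`, `|J^μ[a]| ≤ 2 ∑|a_ν|`, Young's inequality with `ε = 1/32`. Pure real algebra over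
`Fin 4`; `Kerr.etaComp` is the tree's Minkowski component function.
-/

noncomputable section

namespace Summit.FinalStateConjecture.FinalStateConjecture.Theorems

open Literature.Geometry.Lorentzian Finset
open scoped BigOperators

-- every `Summit.FinalStateConjecture.FinalStateConjecture.…` name repeats the summit = sub-problem segment (D-0017 layout)
set_option linter.dupNamespace false

/-- `|η^{μν}| ≤ 1`. -/
theorem kerr_abs_etaComp_le_one (μ ν : Fin 4) : |Kerr.etaComp μ ν| ≤ 1 := by
  unfold Kerr.etaComp
  split_ifs <;> simp

/-- `∑_ν η^{μν} c_ν = η^{μμ} c_μ` (the Minkowski components are diagonal). -/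
theorem kerr_sum_etaComp_mul (μ : Fin 4) (c : Fin 4 → ℝ) :
    ∑ ν, Kerr.etaComp μ ν * c ν = (if μ = 0 then -1 else 1) * c μ := by
  have h : ∀ ν, Kerr.etaComp μ ν * c ν = if μ = ν then (if μ = 0 then -1 else 1) * c ν else 0 := by
    intro ν
    unfold Kerr.etaComp
    split_ifs <;> simp
  simp_rw [h]
  rw [Finset.sum_ite_eq]
  simp

/-- The Minkowski quadratic form: `∑_{μν} η^{μν} a_ν a_μ = −a₀² + ∑ᵢ a_{i+1}²`. -/
theorem kerr_sum_sum_etaComp_mul_mul (a : Fin 4 → ℝ) :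
    ∑ μ, (∑ ν, Kerr.etaComp μ ν * a ν) * a μ = -(a 0) ^ 2 + ∑ i : Fin 3, (a i.succ) ^ 2 := by
  simp_rw [kerr_sum_etaComp_mul]
  rw [Fin.sum_univ_succ]
  simp only [↓reduceIte, Fin.succ_ne_zero, neg_mul, one_mul]
  ring_nf

/-- **Components of an `h`-close inverse metric are at most `2` in absolute value** (`h ≤ 1`). -/
theorem kerr_abs_g_le_two {g : Fin 4 → Fin 4 → ℝ} {h : ℝ} (hh1 : h ≤ 1)
    (hg : ∀ μ ν, |g μ ν - Kerr.etaComp μ ν| ≤ h) (μ ν : Fin 4) : |g μ ν| ≤ 2 := by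
  have h1 := hg μ ν
  have h2 := kerr_abs_etaComp_le_one μ ν
  calc |g μ ν| = |(g μ ν - Kerr.etaComp μ ν) + Kerr.etaComp μ ν| := by ring_nf
    _ ≤ |g μ ν - Kerr.etaComp μ ν| + |Kerr.etaComp μ ν| := abs_add_le _ _
    _ ≤ 1 + 1 := add_le_add (h1.trans hh1) h2
    _ = 2 := by norm_num

/-- **The current is controlled by the `ℓ¹` size of the covector**: `|J^μ[a]| ≤ 2 ∑_ν |a_ν|`. -/
theorem kerr_abs_J_le {g : Fin 4 → Fin 4 → ℝ} {h : ℝ} (hh1 : h ≤ 1)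
    (hg : ∀ μ ν, |g μ ν - Kerr.etaComp μ ν| ≤ h) (a : Fin 4 → ℝ) (μ : Fin 4) :
    |∑ ν, g μ ν * a ν| ≤ 2 * ∑ ν, |a ν| := by
  calc |∑ ν, g μ ν * a ν| ≤ ∑ ν, |g μ ν * a ν| := Finset.abs_sum_le_sum_abs _ _
    _ ≤ ∑ ν, 2 * |a ν| := Finset.sum_le_sum fun ν _ ↦ by
        rw [abs_mul]
        exact mul_le_mul_of_nonneg_right (kerr_abs_g_le_two hh1 hg μ ν) (abs_nonneg _)
    _ = 2 * ∑ ν, |a ν| := by rw [Finset.mul_sum]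

/-- **The metric quadratic form is Minkowski up to `h (∑|a|)²`**:
`∑_{μν} g^{μν} a_ν a_μ ≥ −a₀² + ∑ᵢ a_{i+1}² − h (∑_ν |a_ν|)²`. -/
theorem kerr_Q_lower {g : Fin 4 → Fin 4 → ℝ} {h : ℝ}
    (hg : ∀ μ ν, |g μ ν - Kerr.etaComp μ ν| ≤ h) (a : Fin 4 → ℝ) :
    -(a 0) ^ 2 + ∑ i : Fin 3, (a i.succ) ^ 2 - h * (∑ ν, |a ν|) ^ 2 ≤
      ∑ μ, (∑ ν, g μ ν * a ν) * a μ := by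
  have hsplit : ∑ μ, (∑ ν, g μ ν * a ν) * a μ =
      ∑ μ, (∑ ν, Kerr.etaComp μ ν * a ν) * a μ +
        ∑ μ, (∑ ν, (g μ ν - Kerr.etaComp μ ν) * a ν) * a μ := by
    rw [← Finset.sum_add_distrib]
    refine Finset.sum_congr rfl fun μ _ ↦ ?_
    rw [← add_mul, ← Finset.sum_add_distrib]
    congr 1
    exact Finset.sum_congr rfl fun ν _ ↦ by ring
  rw [hsplit, kerr_sum_sum_etaComp_mul_mul]
  have hdev : |∑ μ, (∑ ν, (g μ ν - Kerr.etaComp μ ν) * a ν) * a μ| ≤ h * (∑ ν, |a ν|) ^ 2 := by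
    calc |∑ μ, (∑ ν, (g μ ν - Kerr.etaComp μ ν) * a ν) * a μ|
        ≤ ∑ μ, |(∑ ν, (g μ ν - Kerr.etaComp μ ν) * a ν) * a μ| := Finset.abs_sum_le_sum_abs _ _
      _ ≤ ∑ μ, (∑ ν, h * |a ν|) * |a μ| := Finset.sum_le_sum fun μ _ ↦ by
          rw [abs_mul]
          refine mul_le_mul_of_nonneg_right ?_ (abs_nonneg _)
          refine (Finset.abs_sum_le_sum_abs _ _).trans (Finset.sum_le_sum fun ν _ ↦ ?_)
          rw [abs_mul]
          exact mul_le_mul_of_nonneg_right (hg μ ν) (abs_nonneg _)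
      _ = h * (∑ ν, |a ν|) ^ 2 := by
          rw [← Finset.mul_sum, ← Finset.mul_sum]; ring
  have := neg_abs_le (∑ μ, (∑ ν, (g μ ν - Kerr.etaComp μ ν) * a ν) * a μ)
  linarith

/-- `(∑_ν |a_ν|)² ≤ 4 ∑_ν a_ν²` on `Fin 4` (Cauchy–Schwarz). -/
theorem kerr_sq_sum_abs_le (a : Fin 4 → ℝ) : (∑ ν, |a ν|) ^ 2 ≤ 4 * ∑ ν, (a ν) ^ 2 := by
  have h := sq_sum_le_card_mul_sum_sq (s := Finset.univ) (f := fun ν : Fin 4 ↦ |a ν|)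
  simp only [Finset.card_univ, Fintype.card_fin, Nat.cast_ofNat, sq_abs] at h
  exact h

/-- Young's inequality with parameter `32`: `2 x y ≤ x²/32 + 32 y²`. -/
theorem kerr_young_32 (x y : ℝ) : 2 * x * y ≤ x ^ 2 / 32 + 32 * y ^ 2 := by
  nlinarith [sq_nonneg (x - 32 * y)]

/-- **The pointwise Lagrangian inequality.** Let `g` be `h`-close to the Minkowski components,
`h ≤ 1/72`; `a, b : Fin 4 → ℝ` with currents `J^μ[a] = ∑_ν g^{μν} a_ν`, `J^μ[b]`; real numbers
`ν, ω, Φ₀, X₀, z` and `d : Fin 3 → ℝ` with `|Φ₀|, |X₀| ≤ C_b`, `a₀ = νΦ₀ − ωX₀`, `b₀ = ωΦ₀ + νX₀`,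
`|z| ≤ 1`, `|dᵢ| ≤ K_d`. Then
`(4/9) z² (|∇a|² + |∇b|²) ≤ F_a + F_b + 132 ((|ν|+|ω|) C_b)² + 2304 (C_b K_d)²`, where
`F_a = −(ν J⁰[a] − ω J⁰[b]) z² Φ₀ + ∑ᵢ J^{i+1}[a] (2 z dᵢ Φ₀ + z² a_{i+1})` and
`F_b = −(ν J⁰[b] + ω J⁰[a]) z² X₀ + ∑ᵢ J^{i+1}[b] (2 z dᵢ X₀ + z² b_{i+1})` are the integrands of
the slice identity `∫ ∂ᵢ(ζ² ψ̃ J^{i+1}[ψ̃]) = 0` (with `z = ζ`, `dᵢ = ∂ᵢζ`, after the substitutions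
`∑_μ ∂_μ J^μ = □_g ψ̃ = 0`, `∂₀ J⁰[ψ̃] = ν J⁰[ψ̃] − ω J⁰[χ̃]`). Proof: `∑ᵢ J^{i+1}[a] a_{i+1} =
Q[a] − J⁰[a] a₀` with `Q[a] ≥ −a₀² + |∇a|² − h(∑|a|)²`, `|J^μ| ≤ 2∑|a|`, `(∑|a|)² ≤ 4(a₀² + |∇a|²)`,
`a₀², b₀² ≤ ((|ν|+|ω|)C_b)²`, and Young's inequality with `ε = 1/32`. -/
theorem kerr_lagrangian_pointwise {g : Fin 4 → Fin 4 → ℝ} {h : ℝ} (hh : h ≤ 1 / 72)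
    (hg : ∀ μ ν, |g μ ν - Kerr.etaComp μ ν| ≤ h) (a b Ja Jb : Fin 4 → ℝ)
    (hJa : ∀ μ, Ja μ = ∑ ν, g μ ν * a ν) (hJb : ∀ μ, Jb μ = ∑ ν, g μ ν * b ν)
    {ν w Φ₀ X₀ Cb z Kd : ℝ} (d : Fin 3 → ℝ) (hΦ₀ : |Φ₀| ≤ Cb) (hX₀ : |X₀| ≤ Cb)
    (ha0 : a 0 = ν * Φ₀ - w * X₀) (hb0 : b 0 = w * Φ₀ + ν * X₀) (hz : |z| ≤ 1)
    (hd : ∀ i, |d i| ≤ Kd) :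
    4 / 9 * (z ^ 2 * (∑ i : Fin 3, (a i.succ) ^ 2 + ∑ i : Fin 3, (b i.succ) ^ 2)) ≤
      (-(ν * Ja 0 - w * Jb 0) * (z ^ 2 * Φ₀) +
          ∑ i : Fin 3, Ja i.succ * (2 * z * d i * Φ₀ + z ^ 2 * a i.succ)) +
        (-(ν * Jb 0 + w * Ja 0) * (z ^ 2 * X₀) +
          ∑ i : Fin 3, Jb i.succ * (2 * z * d i * X₀ + z ^ 2 * b i.succ)) +
        (132 * ((|ν| + |w|) * Cb) ^ 2 + 2304 * (Cb * Kd) ^ 2) := by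
  have hh1 : h ≤ 1 := hh.trans (by norm_num)
  have hCb : 0 ≤ Cb := (abs_nonneg _).trans hΦ₀
  have hKd : 0 ≤ Kd := (abs_nonneg _).trans (hd 0)
  -- sizes of the covectors
  set Sa : ℝ := ∑ μ, |a μ| with hSa
  set Sb : ℝ := ∑ μ, |b μ| with hSb
  set Na : ℝ := ∑ i : Fin 3, (a i.succ) ^ 2 with hNa
  set Nb : ℝ := ∑ i : Fin 3, (b i.succ) ^ 2 with hNb
  have hSa0 : 0 ≤ Sa := Finset.sum_nonneg fun _ _ ↦ abs_nonneg _
  have hSb0 : 0 ≤ Sb := Finset.sum_nonneg fun _ _ ↦ abs_nonneg _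
  have hNa0 : 0 ≤ Na := Finset.sum_nonneg fun _ _ ↦ sq_nonneg _
  have hNb0 : 0 ≤ Nb := Finset.sum_nonneg fun _ _ ↦ sq_nonneg _
  have hsa : ∑ μ, (a μ) ^ 2 = (a 0) ^ 2 + Na := by rw [Fin.sum_univ_succ]
  have hsb : ∑ μ, (b μ) ^ 2 = (b 0) ^ 2 + Nb := by rw [Fin.sum_univ_succ]
  have hSa2 : Sa ^ 2 ≤ 4 * ((a 0) ^ 2 + Na) := by rw [← hsa]; exact kerr_sq_sum_abs_le a
  have hSb2 : Sb ^ 2 ≤ 4 * ((b 0) ^ 2 + Nb) := by rw [← hsb]; exact kerr_sq_sum_abs_le b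
  -- the bound `α₀` for the time components
  set α : ℝ := (|ν| + |w|) * Cb with hα
  have hα0 : 0 ≤ α := by positivity
  have ha0b : |a 0| ≤ α := by
    rw [ha0, hα]
    calc |ν * Φ₀ - w * X₀| ≤ |ν * Φ₀| + |w * X₀| := abs_sub _ _
      _ = |ν| * |Φ₀| + |w| * |X₀| := by rw [abs_mul, abs_mul]
      _ ≤ |ν| * Cb + |w| * Cb := by gcongr
      _ = (|ν| + |w|) * Cb := by ring
  have hb0b : |b 0| ≤ α := by
    rw [hb0, hα]
    calc |w * Φ₀ + ν * X₀| ≤ |w * Φ₀| + |ν * X₀| := abs_add_le _ _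
      _ = |w| * |Φ₀| + |ν| * |X₀| := by rw [abs_mul, abs_mul]
      _ ≤ |w| * Cb + |ν| * Cb := by gcongr
      _ = (|ν| + |w|) * Cb := by ring
  have ha0sq : (a 0) ^ 2 ≤ α ^ 2 := by rw [← sq_abs]; exact pow_le_pow_left₀ (abs_nonneg _) ha0b 2
  have hb0sq : (b 0) ^ 2 ≤ α ^ 2 := by rw [← sq_abs]; exact pow_le_pow_left₀ (abs_nonneg _) hb0b 2
  -- the currents
  have hJa_le : ∀ μ, |Ja μ| ≤ 2 * Sa := fun μ ↦ by rw [hJa μ]; exact kerr_abs_J_le hh1 hg a μ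
  have hJb_le : ∀ μ, |Jb μ| ≤ 2 * Sb := fun μ ↦ by rw [hJb μ]; exact kerr_abs_J_le hh1 hg b μ
  -- the quadratic forms
  have hQa : -(a 0) ^ 2 + Na - h * Sa ^ 2 ≤ ∑ μ, Ja μ * a μ := by
    have := kerr_Q_lower hg a
    simp_rw [← hJa] at this
    exact this
  have hQb : -(b 0) ^ 2 + Nb - h * Sb ^ 2 ≤ ∑ μ, Jb μ * b μ := by
    have := kerr_Q_lower hg b
    simp_rw [← hJb] at this
    exact this
  have hQa' : ∑ i : Fin 3, Ja i.succ * a i.succ = (∑ μ, Ja μ * a μ) - Ja 0 * a 0 := by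
    rw [Fin.sum_univ_succ (n := 3)]; ring
  have hQb' : ∑ i : Fin 3, Jb i.succ * b i.succ = (∑ μ, Jb μ * b μ) - Jb 0 * b 0 := by
    rw [Fin.sum_univ_succ (n := 3)]; ring
  -- the cross terms with the cut-off slope
  have hcross_a : |∑ i : Fin 3, Ja i.succ * d i| ≤ 6 * Sa * Kd := by
    calc |∑ i : Fin 3, Ja i.succ * d i| ≤ ∑ i : Fin 3, |Ja i.succ * d i| :=
          Finset.abs_sum_le_sum_abs _ _
      _ ≤ ∑ i : Fin 3, (2 * Sa) * Kd := Finset.sum_le_sum fun i _ ↦ by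
          rw [abs_mul]; exact mul_le_mul (hJa_le _) (hd i) (abs_nonneg _) (by positivity)
      _ = 6 * Sa * Kd := by simp; ring
  have hcross_b : |∑ i : Fin 3, Jb i.succ * d i| ≤ 6 * Sb * Kd := by
    calc |∑ i : Fin 3, Jb i.succ * d i| ≤ ∑ i : Fin 3, |Jb i.succ * d i| :=
          Finset.abs_sum_le_sum_abs _ _
      _ ≤ ∑ i : Fin 3, (2 * Sb) * Kd := Finset.sum_le_sum fun i _ ↦ by
          rw [abs_mul]; exact mul_le_mul (hJb_le _) (hd i) (abs_nonneg _) (by positivity)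
      _ = 6 * Sb * Kd := by simp; ring
  -- rewrite the two integrands
  have hFa : -(ν * Ja 0 - w * Jb 0) * (z ^ 2 * Φ₀) +
      ∑ i : Fin 3, Ja i.succ * (2 * z * d i * Φ₀ + z ^ 2 * a i.succ) =
      -(ν * Ja 0 - w * Jb 0) * Φ₀ * z ^ 2 + 2 * z * Φ₀ * (∑ i : Fin 3, Ja i.succ * d i) +
        z ^ 2 * ((∑ μ, Ja μ * a μ) - Ja 0 * a 0) := by
    rw [← hQa']
    have : ∑ i : Fin 3, Ja i.succ * (2 * z * d i * Φ₀ + z ^ 2 * a i.succ) =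
        2 * z * Φ₀ * (∑ i : Fin 3, Ja i.succ * d i) + z ^ 2 * (∑ i : Fin 3, Ja i.succ * a i.succ) := by
      rw [Finset.mul_sum, Finset.mul_sum, ← Finset.sum_add_distrib]
      exact Finset.sum_congr rfl fun i _ ↦ by ring
    rw [this]; ring
  have hFb : -(ν * Jb 0 + w * Ja 0) * (z ^ 2 * X₀) +
      ∑ i : Fin 3, Jb i.succ * (2 * z * d i * X₀ + z ^ 2 * b i.succ) =
      -(ν * Jb 0 + w * Ja 0) * X₀ * z ^ 2 + 2 * z * X₀ * (∑ i : Fin 3, Jb i.succ * d i) +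
        z ^ 2 * ((∑ μ, Jb μ * b μ) - Jb 0 * b 0) := by
    rw [← hQb']
    have : ∑ i : Fin 3, Jb i.succ * (2 * z * d i * X₀ + z ^ 2 * b i.succ) =
        2 * z * X₀ * (∑ i : Fin 3, Jb i.succ * d i) + z ^ 2 * (∑ i : Fin 3, Jb i.succ * b i.succ) := by
      rw [Finset.mul_sum, Finset.mul_sum, ← Finset.sum_add_distrib]
      exact Finset.sum_congr rfl fun i _ ↦ by ring
    rw [this]; ring
  rw [hFa, hFb]
  -- scalar bounds on the pieces
  have hz2 : z ^ 2 ≤ 1 := by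
    have := pow_le_pow_left₀ (abs_nonneg z) hz 2
    rwa [sq_abs, one_pow] at this
  have hz0 : 0 ≤ z ^ 2 := sq_nonneg z
  have habsz : |z| ^ 2 = z ^ 2 := sq_abs z
  -- (1) the `ν, ω` terms: `|(ν Ja0 − ω Jb0) Φ₀| ≤ 2 Cb (|ν| Sa + |ω| Sb)`
  have h1a : |(ν * Ja 0 - w * Jb 0) * Φ₀| ≤ 2 * Cb * (|ν| * Sa + |w| * Sb) := by
    rw [abs_mul]
    have h1 : |ν * Ja 0 - w * Jb 0| ≤ |ν| * (2 * Sa) + |w| * (2 * Sb) := by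
      calc |ν * Ja 0 - w * Jb 0| ≤ |ν * Ja 0| + |w * Jb 0| := abs_sub _ _
        _ = |ν| * |Ja 0| + |w| * |Jb 0| := by rw [abs_mul, abs_mul]
        _ ≤ |ν| * (2 * Sa) + |w| * (2 * Sb) := by
            gcongr
            · exact hJa_le 0
            · exact hJb_le 0
    calc |ν * Ja 0 - w * Jb 0| * |Φ₀| ≤ (|ν| * (2 * Sa) + |w| * (2 * Sb)) * Cb :=
          mul_le_mul h1 hΦ₀ (abs_nonneg _) (by positivity)
      _ = 2 * Cb * (|ν| * Sa + |w| * Sb) := by ring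
  have h1b : |(ν * Jb 0 + w * Ja 0) * X₀| ≤ 2 * Cb * (|ν| * Sb + |w| * Sa) := by
    rw [abs_mul]
    have h1 : |ν * Jb 0 + w * Ja 0| ≤ |ν| * (2 * Sb) + |w| * (2 * Sa) := by
      calc |ν * Jb 0 + w * Ja 0| ≤ |ν * Jb 0| + |w * Ja 0| := abs_add_le _ _
        _ = |ν| * |Jb 0| + |w| * |Ja 0| := by rw [abs_mul, abs_mul]
        _ ≤ |ν| * (2 * Sb) + |w| * (2 * Sa) := by
            gcongr
            · exact hJb_le 0
            · exact hJa_le 0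
    calc |ν * Jb 0 + w * Ja 0| * |X₀| ≤ (|ν| * (2 * Sb) + |w| * (2 * Sa)) * Cb :=
          mul_le_mul h1 hX₀ (abs_nonneg _) (by positivity)
      _ = 2 * Cb * (|ν| * Sb + |w| * Sa) := by ring
  -- (2) `|Ja0 a0| ≤ 2 Sa α`, `|Jb0 b0| ≤ 2 Sb α`
  have h2a : |Ja 0 * a 0| ≤ 2 * Sa * α := by
    rw [abs_mul]; exact mul_le_mul (hJa_le 0) ha0b (abs_nonneg _) (by positivity)
  have h2b : |Jb 0 * b 0| ≤ 2 * Sb * α := by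
    rw [abs_mul]; exact mul_le_mul (hJb_le 0) hb0b (abs_nonneg _) (by positivity)
  -- (3) the cross terms: `|2 z Φ₀ cross_a| ≤ 12 Cb Kd |z| Sa`
  have h3a : |2 * z * Φ₀ * (∑ i : Fin 3, Ja i.succ * d i)| ≤ 12 * Cb * Kd * (|z| * Sa) := by
    rw [abs_mul, abs_mul, abs_mul, abs_two]
    calc 2 * |z| * |Φ₀| * |∑ i : Fin 3, Ja i.succ * d i| ≤ 2 * |z| * Cb * (6 * Sa * Kd) := by
          gcongr
      _ = 12 * Cb * Kd * (|z| * Sa) := by ring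
  have h3b : |2 * z * X₀ * (∑ i : Fin 3, Jb i.succ * d i)| ≤ 12 * Cb * Kd * (|z| * Sb) := by
    rw [abs_mul, abs_mul, abs_mul, abs_two]
    calc 2 * |z| * |X₀| * |∑ i : Fin 3, Jb i.succ * d i| ≤ 2 * |z| * Cb * (6 * Sb * Kd) := by
          gcongr
      _ = 12 * Cb * Kd * (|z| * Sb) := by ring
  -- `(Cb|ν|)² + (Cb|ω|)² ≤ α²`
  have hνw : (Cb * |ν|) ^ 2 + (Cb * |w|) ^ 2 ≤ α ^ 2 := by
    have h0 : 0 ≤ 2 * (Cb * |ν|) * (Cb * |w|) := by positivity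
    have : α ^ 2 = (Cb * |ν|) ^ 2 + (Cb * |w|) ^ 2 + 2 * (Cb * |ν|) * (Cb * |w|) := by rw [hα]; ring
    linarith
  -- assemble: lower bounds for the pieces of the two integrands (all linear in monomials)
  have hC := neg_abs_le (2 * z * Φ₀ * (∑ i : Fin 3, Ja i.succ * d i))
  have hD := neg_abs_le (2 * z * X₀ * (∑ i : Fin 3, Jb i.succ * d i))
  have hE := le_abs_self (Ja 0 * a 0)
  have hF := le_abs_self (Jb 0 * b 0)
  have hqa : -(a 0) ^ 2 + Na - h * Sa ^ 2 - 2 * Sa * α ≤ (∑ μ, Ja μ * a μ) - Ja 0 * a 0 := by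
    linarith [hQa, hE, h2a]
  have hqb : -(b 0) ^ 2 + Nb - h * Sb ^ 2 - 2 * Sb * α ≤ (∑ μ, Jb μ * b μ) - Jb 0 * b 0 := by
    linarith [hQb, hF, h2b]
  have hmain_a : z ^ 2 * (-(a 0) ^ 2 + Na - h * Sa ^ 2 - 2 * Sa * α) ≤
      z ^ 2 * ((∑ μ, Ja μ * a μ) - Ja 0 * a 0) := mul_le_mul_of_nonneg_left hqa hz0
  have hmain_b : z ^ 2 * (-(b 0) ^ 2 + Nb - h * Sb ^ 2 - 2 * Sb * α) ≤
      z ^ 2 * ((∑ μ, Jb μ * b μ) - Jb 0 * b 0) := mul_le_mul_of_nonneg_left hqb hz0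
  have hla : -(2 * Cb * (|ν| * Sa + |w| * Sb)) ≤ -(ν * Ja 0 - w * Jb 0) * Φ₀ := by
    have := le_abs_self ((ν * Ja 0 - w * Jb 0) * Φ₀)
    linarith
  have hlb : -(2 * Cb * (|ν| * Sb + |w| * Sa)) ≤ -(ν * Jb 0 + w * Ja 0) * X₀ := by
    have := le_abs_self ((ν * Jb 0 + w * Ja 0) * X₀)
    linarith
  have hlin_a : -(2 * Cb * (|ν| * Sa + |w| * Sb)) * z ^ 2 ≤ -(ν * Ja 0 - w * Jb 0) * Φ₀ * z ^ 2 :=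
    mul_le_mul_of_nonneg_right hla hz0
  have hlin_b : -(2 * Cb * (|ν| * Sb + |w| * Sa)) * z ^ 2 ≤ -(ν * Jb 0 + w * Ja 0) * X₀ * z ^ 2 :=
    mul_le_mul_of_nonneg_right hlb hz0
  -- Young's inequalities (ε = 1/32), multiplied by `z²` where needed
  have hy1 : z ^ 2 * (2 * Sa * α) ≤ z ^ 2 * (Sa ^ 2 / 32 + 32 * α ^ 2) :=
    mul_le_mul_of_nonneg_left (kerr_young_32 Sa α) hz0
  have hy2 : z ^ 2 * (2 * Sb * α) ≤ z ^ 2 * (Sb ^ 2 / 32 + 32 * α ^ 2) :=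
    mul_le_mul_of_nonneg_left (kerr_young_32 Sb α) hz0
  have hy3 : z ^ 2 * (2 * Sa * (Cb * |ν|)) ≤ z ^ 2 * (Sa ^ 2 / 32 + 32 * (Cb * |ν|) ^ 2) :=
    mul_le_mul_of_nonneg_left (kerr_young_32 Sa (Cb * |ν|)) hz0
  have hy4 : z ^ 2 * (2 * Sb * (Cb * |w|)) ≤ z ^ 2 * (Sb ^ 2 / 32 + 32 * (Cb * |w|) ^ 2) :=
    mul_le_mul_of_nonneg_left (kerr_young_32 Sb (Cb * |w|)) hz0
  have hy5 : z ^ 2 * (2 * Sb * (Cb * |ν|)) ≤ z ^ 2 * (Sb ^ 2 / 32 + 32 * (Cb * |ν|) ^ 2) :=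
    mul_le_mul_of_nonneg_left (kerr_young_32 Sb (Cb * |ν|)) hz0
  have hy6 : z ^ 2 * (2 * Sa * (Cb * |w|)) ≤ z ^ 2 * (Sa ^ 2 / 32 + 32 * (Cb * |w|) ^ 2) :=
    mul_le_mul_of_nonneg_left (kerr_young_32 Sa (Cb * |w|)) hz0
  have hy7 : 2 * (|z| * Sa) * (6 * Cb * Kd) ≤ z ^ 2 * Sa ^ 2 / 32 + 32 * (6 * Cb * Kd) ^ 2 := by
    have := kerr_young_32 (|z| * Sa) (6 * Cb * Kd)
    rwa [mul_pow, habsz] at this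
  have hy8 : 2 * (|z| * Sb) * (6 * Cb * Kd) ≤ z ^ 2 * Sb ^ 2 / 32 + 32 * (6 * Cb * Kd) ^ 2 := by
    have := kerr_young_32 (|z| * Sb) (6 * Cb * Kd)
    rwa [mul_pow, habsz] at this
  -- `z² ≤ 1` bookkeeping
  have hzSa2 : z ^ 2 * Sa ^ 2 ≤ 4 * (z ^ 2 * (a 0) ^ 2) + 4 * (z ^ 2 * Na) := by
    have := mul_le_mul_of_nonneg_left hSa2 hz0; linarith
  have hzSb2 : z ^ 2 * Sb ^ 2 ≤ 4 * (z ^ 2 * (b 0) ^ 2) + 4 * (z ^ 2 * Nb) := by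
    have := mul_le_mul_of_nonneg_left hSb2 hz0; linarith
  have hzα : z ^ 2 * α ^ 2 ≤ α ^ 2 := mul_le_of_le_one_left (sq_nonneg α) hz2
  have hza0 : z ^ 2 * (a 0) ^ 2 ≤ α ^ 2 := (mul_le_mul_of_nonneg_left ha0sq hz0).trans hzα
  have hzb0 : z ^ 2 * (b 0) ^ 2 ≤ α ^ 2 := (mul_le_mul_of_nonneg_left hb0sq hz0).trans hzα
  have hzνw : z ^ 2 * (Cb * |ν|) ^ 2 + z ^ 2 * (Cb * |w|) ^ 2 ≤ α ^ 2 := by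
    have := mul_le_mul_of_nonneg_left hνw hz0
    rw [mul_add] at this
    exact this.trans hzα
  have hhz : h * (z ^ 2 * Sa ^ 2) ≤ 1 / 72 * (z ^ 2 * Sa ^ 2) :=
    mul_le_mul_of_nonneg_right hh (by positivity)
  have hhz' : h * (z ^ 2 * Sb ^ 2) ≤ 1 / 72 * (z ^ 2 * Sb ^ 2) :=
    mul_le_mul_of_nonneg_right hh (by positivity)
  have hzNa : 0 ≤ z ^ 2 * Na := mul_nonneg hz0 hNa0
  have hzNb : 0 ≤ z ^ 2 * Nb := mul_nonneg hz0 hNb0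
  -- final linear combination
  linarith [hmain_a, hmain_b, hlin_a, hlin_b, hC, hD, h3a, h3b, hy1, hy2, hy3, hy4, hy5, hy6,
    hy7, hy8, hzSa2, hzSb2, hza0, hzb0, hzνw, hzα, hhz, hhz', hzNa, hzNb, sq_nonneg (Cb * Kd),
    sq_nonneg α]

end Summit.FinalStateConjecture.FinalStateConjecture.Theorems

end
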